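import Literature.Algebra.Homology.GroupCohomologySemilinear
import HarnessLib

/-!
# A bijective semilinear equivariant map of coefficients is bijective on group cohomology

Topic `Algebra/Homology`; namespace `Literature.Algebra.Homology`.  A *proofs* file (theorems only)
on top of `GroupCohomologySemilinear` (`semimap s hs n : Hⁿ(G, A) →ₛₗ[σ] Hⁿ(G, B)` for a
`σ`-semilinear `G`-equivariant `s : A → B`, `σ : k → k'`).

* `cochainsSemimap_injective`, `cochainsSemimap_surjInv`: post-composition with an injective `s`
  is injective on cochains; with a surjective `s`, every cochain of `B` is `s ∘ (s⁻¹ ∘ f)`.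
* `cocyclesSemimap_injective`.
* **`semimap_bijective_of_bijective`** (with `semimap_injective_of_bijective`,
  `semimap_surjective_of_bijective`): if `s` is bijective then `Hⁿ(s)` is bijective — even though
  `σ` need not be invertible.  Use: comparison of `Hⁿ(G, -)` of ONE additive `G`-module computed
  over two coefficient rings (restriction of scalars along `σ`, `s = id`), e.g. `ℤ/p^s`-valued versus
  `𝒪/p^s`-valued structures on the same torsion coefficients in [Scholze2015, §V.4].

The standard cochain complex only sees the additive group and the `G`-action of the coefficients
[Brown1982CohomologyGroups, III.1 Example 3], so a bijective additive equivariant map induces an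
isomorphism of complexes of abelian groups, hence of cohomology.

## References

* K. S. Brown, *Cohomology of Groups*, GTM 87 (1982), III.1 Example 3 [Brown1982CohomologyGroups].
* P. Scholze, Ann. of Math. 182 (2015), §V.4 [Scholze2015].
-/

noncomputable section

open CategoryTheory groupCohomology

namespace Literature.Algebra.Homology

universe u

variable {k k' : Type u} [CommRing k] [CommRing k'] {G : Type u} [Group G] {σ : k →+* k'}
  {A : Rep k G} {B : Rep k' G}

/-- Post-composition with an injective map of coefficients is injective on cochains. [folklore] -/
theorem cochainsSemimap_injective (s : A.V →ₛₗ[σ] B.V) (hinj : Function.Injective s) (n : ℕ) :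
    Function.Injective (cochainsSemimap s n) := fun f f' h =>
  funext fun g => hinj (by rw [← cochainsSemimap_apply s n f g, h, cochainsSemimap_apply])

/-- With `s` surjective, `s ∘ (s⁻¹ ∘ f) = f` for every cochain `f` of `B` (`s⁻¹ = Function.surjInv`).
[folklore] -/
theorem cochainsSemimap_surjInv (s : A.V →ₛₗ[σ] B.V) (hsurj : Function.Surjective s) (n : ℕ)
    (f : (Fin n → G) → B.V) :
    cochainsSemimap s n (fun g => Function.surjInv hsurj (f g)) = f :=
  funext fun g => by rw [cochainsSemimap_apply, Function.surjInv_eq hsurj]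

/-- `s_*` is injective on cocycles when `s` is injective. [folklore] -/
theorem cocyclesSemimap_injective (s : A.V →ₛₗ[σ] B.V)
    (hs : ∀ (g : G) (a : A.V), s (A.ρ g a) = B.ρ g (s a)) (hinj : Function.Injective s) (n : ℕ) :
    Function.Injective (cocyclesSemimap s hs n) := fun z z' h =>
  iCocycles_injective A n (cochainsSemimap_injective s hinj n (by
    rw [← iCocycles_cocyclesSemimap s hs, ← iCocycles_cocyclesSemimap s hs, h]))

/-- **`Hⁿ(s)` is surjective when `s` is bijective**: a cocycle `z` of `B` is `s ∘ w` with
`w = s⁻¹ ∘ z` a cocycle of `A` (`s ∘ δw = δ(s ∘ w) = δz = 0` and `s` is injective).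
[cite: Brown1982CohomologyGroups, III.1 Example 3] -/
theorem semimap_surjective_of_bijective (s : A.V →ₛₗ[σ] B.V)
    (hs : ∀ (g : G) (a : A.V), s (A.ρ g a) = B.ρ g (s a)) (hb : Function.Bijective s) (n : ℕ) :
    Function.Surjective (semimap s hs n) := by
  intro x
  obtain ⟨z, rfl⟩ := π_surjective B n x
  let w' : (Fin n → G) → A.V := fun g => Function.surjInv hb.2 (iCocycles B n z g)
  have hw' : cochainsSemimap s n w' = iCocycles B n z := cochainsSemimap_surjInv s hb.2 n _
  have hdw' : inhomogeneousCochains.d A n w' = 0 := by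
    refine cochainsSemimap_injective s hb.1 (n + 1) ?_
    rw [← d_cochainsSemimap s hs, hw', d_iCocycles, map_zero]
  refine ⟨groupCohomology.π A n (cocyclesMk w' hdw'), ?_⟩
  rw [semimap_π]
  congr 1
  refine iCocycles_injective B n ?_
  rw [iCocycles_cocyclesSemimap, iCocycles_mk, hw']

/-- **`Hⁿ(s)` is injective when `s` is bijective**: if `s ∘ w = δu` then `w = δ(s⁻¹ ∘ u)`.
[cite: Brown1982CohomologyGroups, III.1 Example 3] -/
theorem semimap_injective_of_bijective (s : A.V →ₛₗ[σ] B.V)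
    (hs : ∀ (g : G) (a : A.V), s (A.ρ g a) = B.ρ g (s a)) (hb : Function.Bijective s) (n : ℕ) :
    Function.Injective (semimap s hs n) := by
  refine (injective_iff_map_eq_zero (semimap s hs n)).2 fun x hx => ?_
  induction x using groupCohomology_induction_on with
  | h w =>
    rw [semimap_π, π_apply_eq_zero_iff] at hx
    obtain ⟨u, hu⟩ := hx
    refine (π_apply_eq_zero_iff A n w).2
      ⟨(fun g => Function.surjInv hb.2 (u g) : (Fin (n - 1) → G) → A.V), ?_⟩
    refine cocyclesSemimap_injective s hs hb.1 n ?_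
    rw [cocyclesSemimap_toCocycles s hs, ← hu]
    congr 1
    exact cochainsSemimap_surjInv s hb.2 (n - 1) u

/-- **A bijective `σ`-semilinear `G`-equivariant map of coefficients induces a bijection
`Hⁿ(G, A) ≃ Hⁿ(G, B)`** (no inverse of `σ` needed: the cochain complexes are isomorphic as complexes
of abelian groups). [cite: Brown1982CohomologyGroups, III.1 Example 3] -/
theorem semimap_bijective_of_bijective (s : A.V →ₛₗ[σ] B.V)
    (hs : ∀ (g : G) (a : A.V), s (A.ρ g a) = B.ρ g (s a)) (hb : Function.Bijective s) (n : ℕ) :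
    Function.Bijective (semimap s hs n) :=
  ⟨semimap_injective_of_bijective s hs hb n, semimap_surjective_of_bijective s hs hb n⟩

end Literature.Algebra.Homology
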